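import Summits.AtomisticToContinuum.Crystallization.Theorems.FreeSplittingCertificatesStrictSplittingRuleCoreFirstOrderDesignTruss

/-!
# `StrictSplittingRule` (stmt-AtomisticToContinuum-12560): Euler–Maclaurin asymptotics of the line-truss tension

Route `FreeSplittingCertificates`, crux r3 `StrictSplittingRule`, line `registered` (unit b2b-freesplit-B, gen 8).
The readout coefficient of the landed first-order design is `β(b,d,s) = λ_s·τ`, `τ` the outgoing tail
`Σ_{m ≥ 1} W′(‖v + m e‖²)⟪v + m e, e⟫` of the load line through `v = V c d` in direction `e = y_s`
(`…CoreFirstOrderDesignTruss.lean`, `h1_master`, `h1_tau_bound`: `|τ| ≤ K(1+‖v‖)⁻⁶`).  The far lemma of the H12⋆ architecture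
(HOME CERT.md §16, FAR-LEMMA-SPEC §7) needs the LEADING TERM: the summand is the derivative of `t ↦ ½W(‖v + t e‖²)`
(`W(σ) = σ⁻⁶/12 − σ⁻³/6`, `W′ = ljSqDeriv`), so the sum telescopes against `−½W(‖v‖²) = −½V_LJ(‖v‖)` up to a second-derivative
(Euler–Maclaurin) error:

* `h1_tail_asymp` — for `‖v‖, ‖e‖ ≥ ρ₀ > 0`, `⟪v, e⟫ ≥ 0`:
  `|Σ_{m≥1} W′(‖v+me‖²)⟪v+me,e⟫ + ½·lennardJones ‖v‖| ≤ 16(2C₂ + C₁)·‖e‖²·((‖v‖⁻¹)⁸ + (‖v‖⁻¹)⁷/(6‖e‖))`,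
  `C₁ = ½(1 + ρ₀⁻⁶)`, `C₂ = 2 + (7/2)ρ₀⁻⁶` — i.e. `τ = ‖v‖⁻⁶/12 + O(‖e‖·‖v‖⁻⁷)`: the readout coefficient is ISOTROPIC at leading
  order, `β → λ_s r⁻⁶/12`, which makes the continuum readout density `(1/24) r⁻⁶|∇v|²` (CERT §16 (2));
* the calculus behind it: `hasDerivAt_ljSqWell` (`W′ = ljSqDeriv`), `hasDerivAt_ljSqDeriv` (`W″ = (7/2)σ⁻⁸ − 2σ⁻⁵`),
  `abs_ljSqDeriv_deriv_le`, the line polynomial `‖v + te‖² = ‖v‖² + 2t⟪v,e⟫ + t²‖e‖²` and the one-step estimate `h1_tail_step`.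

Structural bookkeeping ([folklore]: Euler–Maclaurin to first order for a telescoping summand); VALUE = a kernel-checked brick of the far
lemma — NOT a proof of H12⋆, NOT summit progress.
-/

noncomputable section

namespace Summit.AtomisticToContinuum.Crystallization.Theorems.StrictSplittingRuleBirth

open scoped BigOperators Topology
open Filter Set
open Literature.MathematicalPhysics.StatisticalMechanics
open Summit.AtomisticToContinuum.Crystallization.Theorems.PalmUnimodularRigidity.LayeredLawsSelectHcp

/-! ## §1 One-variable calculus of the squared-length well -/

/-- `W′ = ljSqDeriv`: the squared-length well `W(σ) = σ⁻⁶/12 − σ⁻³/6` has derivative `½(σ⁻⁴ − σ⁻⁷)` at `σ ≠ 0`. [folklore] -/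
theorem hasDerivAt_ljSqWell {σ : ℝ} (hσ : σ ≠ 0) :
    HasDerivAt (fun σ : ℝ => 1 / 12 * (σ⁻¹) ^ 6 - 1 / 6 * (σ⁻¹) ^ 3) (ljSqDeriv σ) σ := by
  have hinv : HasDerivAt (fun s : ℝ => s⁻¹) (-(σ ^ 2)⁻¹) σ := hasDerivAt_inv hσ
  have h6 : HasDerivAt (fun y : ℝ => y⁻¹ ^ 6) (((6 : ℕ) : ℝ) * σ⁻¹ ^ (6 - 1) * -(σ ^ 2)⁻¹) σ := hinv.pow 6
  have h3 : HasDerivAt (fun y : ℝ => y⁻¹ ^ 3) (((3 : ℕ) : ℝ) * σ⁻¹ ^ (3 - 1) * -(σ ^ 2)⁻¹) σ := hinv.pow 3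
  have h : HasDerivAt (fun y : ℝ => 1 / 12 * y⁻¹ ^ 6 - 1 / 6 * y⁻¹ ^ 3)
      (1 / 12 * (((6 : ℕ) : ℝ) * σ⁻¹ ^ (6 - 1) * -(σ ^ 2)⁻¹) -
        1 / 6 * (((3 : ℕ) : ℝ) * σ⁻¹ ^ (3 - 1) * -(σ ^ 2)⁻¹)) σ :=
    HasDerivAt.sub (HasDerivAt.const_mul (1 / 12) h6) (HasDerivAt.const_mul (1 / 6) h3)
  refine HasDerivAt.congr_deriv h ?_
  unfold ljSqDeriv
  push_cast
  field_simp
  ring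

/-- `W″`: `ljSqDeriv` has derivative `(7/2)σ⁻⁸ − 2σ⁻⁵` at `σ ≠ 0`. [folklore] -/
theorem hasDerivAt_ljSqDeriv {σ : ℝ} (hσ : σ ≠ 0) :
    HasDerivAt ljSqDeriv (7 / 2 * (σ⁻¹) ^ 8 - 2 * (σ⁻¹) ^ 5) σ := by
  have hinv : HasDerivAt (fun s : ℝ => s⁻¹) (-(σ ^ 2)⁻¹) σ := hasDerivAt_inv hσ
  have h4 : HasDerivAt (fun y : ℝ => y⁻¹ ^ 4) (((4 : ℕ) : ℝ) * σ⁻¹ ^ (4 - 1) * -(σ ^ 2)⁻¹) σ := hinv.pow 4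
  have h7 : HasDerivAt (fun y : ℝ => y⁻¹ ^ 7) (((7 : ℕ) : ℝ) * σ⁻¹ ^ (7 - 1) * -(σ ^ 2)⁻¹) σ := hinv.pow 7
  have h : HasDerivAt (fun y : ℝ => 1 / 2 * (y⁻¹ ^ 4 - y⁻¹ ^ 7))
      (1 / 2 * (((4 : ℕ) : ℝ) * σ⁻¹ ^ (4 - 1) * -(σ ^ 2)⁻¹ - ((7 : ℕ) : ℝ) * σ⁻¹ ^ (7 - 1) * -(σ ^ 2)⁻¹)) σ :=
    HasDerivAt.const_mul (1 / 2) (HasDerivAt.sub h4 h7)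
  have e : ljSqDeriv = fun y : ℝ => 1 / 2 * (y⁻¹ ^ 4 - y⁻¹ ^ 7) := by funext y; rfl
  rw [e]
  refine HasDerivAt.congr_deriv h ?_
  push_cast
  field_simp
  ring

/-- `|W″(σ)| ≤ (2 + (7/2)σ₀⁻³)·σ⁻⁵` for `σ ≥ σ₀ > 0`. [folklore] -/
theorem abs_ljSqDeriv_deriv_le {σ₀ σ : ℝ} (h0 : 0 < σ₀) (hσ : σ₀ ≤ σ) :
    |7 / 2 * (σ⁻¹) ^ 8 - 2 * (σ⁻¹) ^ 5| ≤ (2 + 7 / 2 * (σ₀⁻¹) ^ 3) * (σ⁻¹) ^ 5 := by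
  have hs : 0 < σ := h0.trans_le hσ
  have hi : σ⁻¹ ≤ σ₀⁻¹ := (inv_le_inv₀ hs h0).2 hσ
  have hi0 : 0 ≤ σ⁻¹ := inv_nonneg.2 hs.le
  have h8 : (σ⁻¹) ^ 8 ≤ (σ₀⁻¹) ^ 3 * (σ⁻¹) ^ 5 := by
    rw [show (σ⁻¹) ^ 8 = (σ⁻¹) ^ 3 * (σ⁻¹) ^ 5 by ring]
    exact mul_le_mul_of_nonneg_right (pow_le_pow_left₀ hi0 hi 3) (by positivity)
  have h5 : 0 ≤ (σ⁻¹) ^ 5 := by positivity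
  have h8' : 0 ≤ (σ⁻¹) ^ 8 := by positivity
  have hc : 0 ≤ 7 / 2 * (σ₀⁻¹) ^ 3 * (σ⁻¹) ^ 5 := by positivity
  rw [abs_le]
  constructor <;> nlinarith [h8, h5, h8', hc]

/-! ## §2 The load line as a function of a real parameter -/

section Line

variable {ρ₀ : ℝ} {v e : EuclideanSpace ℝ (Fin 3)}

/-- The line polynomial: `‖v + t e‖² = ‖v‖² + 2t⟪v,e⟫ + t²‖e‖²`. [folklore] -/
theorem h1_line_norm_sq (v e : EuclideanSpace ℝ (Fin 3)) (t : ℝ) :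
    ‖v + t • e‖ ^ 2 = ‖v‖ ^ 2 + 2 * t * inner ℝ v e + t ^ 2 * ‖e‖ ^ 2 := by
  rw [norm_add_sq_real, real_inner_smul_right, norm_smul, Real.norm_eq_abs, mul_pow, sq_abs]
  ring

/-- The line load factor: `⟪v + t e, e⟫ = ⟪v,e⟫ + t‖e‖²`. [folklore] -/
theorem h1_line_inner (v e : EuclideanSpace ℝ (Fin 3)) (t : ℝ) :
    inner ℝ (v + t • e) e = inner ℝ v e + t * ‖e‖ ^ 2 := by
  rw [inner_add_left, real_inner_smul_left, real_inner_self_eq_norm_sq]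

/-- Lower bounds along an outgoing line: for `t ≥ 0` and `⟪v,e⟫ ≥ 0`,
`‖v + te‖² ≥ ‖v‖² + t²‖e‖² ≥ (‖v‖ + t‖e‖)²/2`. [folklore] -/
theorem h1_line_norm_sq_ge (hve : 0 ≤ inner ℝ v e) {t : ℝ} (ht : 0 ≤ t) :
    ‖v‖ ^ 2 + t ^ 2 * ‖e‖ ^ 2 ≤ ‖v + t • e‖ ^ 2 ∧ (‖v‖ + t * ‖e‖) ^ 2 / 2 ≤ ‖v + t • e‖ ^ 2 := by
  rw [h1_line_norm_sq]
  constructor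
  · nlinarith [mul_nonneg ht hve]
  · nlinarith [mul_nonneg ht hve, sq_nonneg (‖v‖ - t * ‖e‖)]

/-- Monotonicity of `‖v + te‖²` in `t ≥ 0` on an outgoing line. [folklore] -/
theorem h1_line_norm_sq_mono (hve : 0 ≤ inner ℝ v e) {t t' : ℝ} (ht : 0 ≤ t) (htt' : t ≤ t') :
    ‖v + t • e‖ ^ 2 ≤ ‖v + t' • e‖ ^ 2 := by
  rw [h1_line_norm_sq, h1_line_norm_sq]
  have h1 : t ^ 2 ≤ t' ^ 2 := pow_le_pow_left₀ ht htt' 2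
  nlinarith [mul_le_mul_of_nonneg_right htt' hve, mul_le_mul_of_nonneg_right h1 (sq_nonneg ‖e‖)]

/-- Derivative of the line polynomial: `d/dt ‖v + te‖² = 2⟪v,e⟫ + 2t‖e‖²`. [folklore] -/
theorem h1_line_hasDerivAt_norm_sq (v e : EuclideanSpace ℝ (Fin 3)) (t : ℝ) :
    HasDerivAt (fun t : ℝ => ‖v + t • e‖ ^ 2) (2 * inner ℝ v e + 2 * t * ‖e‖ ^ 2) t := by
  have hA : HasDerivAt (fun t : ℝ => 2 * t * inner ℝ v e) (2 * 1 * inner ℝ v e) t :=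
    HasDerivAt.mul_const (HasDerivAt.const_mul 2 (hasDerivAt_id' t)) _
  have hB : HasDerivAt (fun t : ℝ => t ^ 2 * ‖e‖ ^ 2) (((2 : ℕ) : ℝ) * t ^ (2 - 1) * ‖e‖ ^ 2) t :=
    HasDerivAt.mul_const (hasDerivAt_pow 2 t) _
  have hC : HasDerivAt (fun t : ℝ => ‖v‖ ^ 2 + 2 * t * inner ℝ v e + t ^ 2 * ‖e‖ ^ 2)
      (0 + 2 * 1 * inner ℝ v e + ((2 : ℕ) : ℝ) * t ^ (2 - 1) * ‖e‖ ^ 2) t :=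
    HasDerivAt.add (HasDerivAt.add (hasDerivAt_const t _) hA) hB
  have e1 : (fun t : ℝ => ‖v + t • e‖ ^ 2) = fun t => ‖v‖ ^ 2 + 2 * t * inner ℝ v e + t ^ 2 * ‖e‖ ^ 2 :=
    funext fun t => h1_line_norm_sq v e t
  rw [e1]
  refine HasDerivAt.congr_deriv hC ?_
  push_cast
  ring

/-- **The telescoping primitive.**  `Φ(t) = ½W(‖v + te‖²)` has derivative `F(t) = W′(‖v+te‖²)⟪v+te, e⟫` wherever `‖v + te‖ ≠ 0`.
[folklore] -/
theorem h1_line_hasDerivAt_prim {t : ℝ} (hq : ‖v + t • e‖ ^ 2 ≠ 0) :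
    HasDerivAt (fun t : ℝ => 1 / 2 * (1 / 12 * ((‖v + t • e‖ ^ 2)⁻¹) ^ 6 - 1 / 6 * ((‖v + t • e‖ ^ 2)⁻¹) ^ 3))
      (ljSqDeriv (‖v + t • e‖ ^ 2) * inner ℝ (v + t • e) e) t := by
  have hq' : HasDerivAt (fun t : ℝ => ‖v + t • e‖ ^ 2) (2 * inner ℝ v e + 2 * t * ‖e‖ ^ 2) t :=
    h1_line_hasDerivAt_norm_sq v e t
  have hW : HasDerivAt ((fun σ : ℝ => 1 / 12 * (σ⁻¹) ^ 6 - 1 / 6 * (σ⁻¹) ^ 3) ∘ fun t : ℝ => ‖v + t • e‖ ^ 2)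
      (ljSqDeriv (‖v + t • e‖ ^ 2) * (2 * inner ℝ v e + 2 * t * ‖e‖ ^ 2)) t :=
    (hasDerivAt_ljSqWell hq).comp t hq'
  have h2 : HasDerivAt
      (fun t : ℝ => 1 / 2 * (1 / 12 * ((‖v + t • e‖ ^ 2)⁻¹) ^ 6 - 1 / 6 * ((‖v + t • e‖ ^ 2)⁻¹) ^ 3))
      (1 / 2 * (ljSqDeriv (‖v + t • e‖ ^ 2) * (2 * inner ℝ v e + 2 * t * ‖e‖ ^ 2))) t :=
    HasDerivAt.const_mul (1 / 2) hW
  refine HasDerivAt.congr_deriv h2 ?_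
  rw [h1_line_inner]
  ring

/-- **The summand as a function of `t`** has derivative
`F′(t) = W″(‖v+te‖²)·2⟪v+te,e⟫² + W′(‖v+te‖²)·‖e‖²`. [folklore] -/
theorem h1_line_hasDerivAt_load {t : ℝ} (hq : ‖v + t • e‖ ^ 2 ≠ 0) :
    HasDerivAt (fun t : ℝ => ljSqDeriv (‖v + t • e‖ ^ 2) * inner ℝ (v + t • e) e)
      ((7 / 2 * ((‖v + t • e‖ ^ 2)⁻¹) ^ 8 - 2 * ((‖v + t • e‖ ^ 2)⁻¹) ^ 5) * (2 * inner ℝ (v + t • e) e ^ 2) +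
        ljSqDeriv (‖v + t • e‖ ^ 2) * ‖e‖ ^ 2) t := by
  have hq' : HasDerivAt (fun t : ℝ => ‖v + t • e‖ ^ 2) (2 * inner ℝ v e + 2 * t * ‖e‖ ^ 2) t :=
    h1_line_hasDerivAt_norm_sq v e t
  have hin : HasDerivAt (fun t : ℝ => inner ℝ (v + t • e) e) (0 + 1 * ‖e‖ ^ 2) t := by
    have e2 : (fun t : ℝ => inner ℝ (v + t • e) e) = fun t => inner ℝ v e + t * ‖e‖ ^ 2 :=
      funext fun t => h1_line_inner v e t
    rw [e2]
    exact HasDerivAt.add (hasDerivAt_const t _) (HasDerivAt.mul_const (hasDerivAt_id' t) _)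
  have hW : HasDerivAt (ljSqDeriv ∘ fun t : ℝ => ‖v + t • e‖ ^ 2)
      ((7 / 2 * ((‖v + t • e‖ ^ 2)⁻¹) ^ 8 - 2 * ((‖v + t • e‖ ^ 2)⁻¹) ^ 5) * (2 * inner ℝ v e + 2 * t * ‖e‖ ^ 2)) t :=
    (hasDerivAt_ljSqDeriv hq).comp t hq'
  have h2 : HasDerivAt (fun t : ℝ => ljSqDeriv (‖v + t • e‖ ^ 2) * inner ℝ (v + t • e) e)
      ((7 / 2 * ((‖v + t • e‖ ^ 2)⁻¹) ^ 8 - 2 * ((‖v + t • e‖ ^ 2)⁻¹) ^ 5) * (2 * inner ℝ v e + 2 * t * ‖e‖ ^ 2) *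
          inner ℝ (v + t • e) e + ljSqDeriv (‖v + t • e‖ ^ 2) * (0 + 1 * ‖e‖ ^ 2)) t :=
    HasDerivAt.mul hW hin
  refine HasDerivAt.congr_deriv h2 ?_
  rw [h1_line_inner]
  ring

/-- **Derivative bound of the summand** on an outgoing line: for `‖v‖ ≥ ρ₀ > 0`, `⟪v,e⟫ ≥ 0`, `t ≥ 0`,
`|F′(t)| ≤ (2C₂ + C₁)‖e‖²(‖v+te‖²)⁻⁴` with `C₁ = ½(1+ρ₀⁻⁶)`, `C₂ = 2 + (7/2)ρ₀⁻⁶` (Cauchy–Schwarz `⟪v+te,e⟫² ≤ ‖v+te‖²‖e‖²`).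
[folklore] -/
theorem h1_line_load_deriv_le (hρ : 0 < ρ₀) (hv : ρ₀ ≤ ‖v‖) (hve : 0 ≤ inner ℝ v e) {t : ℝ}
    (ht : 0 ≤ t) :
    |(7 / 2 * ((‖v + t • e‖ ^ 2)⁻¹) ^ 8 - 2 * ((‖v + t • e‖ ^ 2)⁻¹) ^ 5) * (2 * inner ℝ (v + t • e) e ^ 2) +
        ljSqDeriv (‖v + t • e‖ ^ 2) * ‖e‖ ^ 2| ≤
      (2 * (2 + 7 / 2 * ((ρ₀ ^ 2)⁻¹) ^ 3) + 1 / 2 * (1 + ((ρ₀ ^ 2)⁻¹) ^ 3)) * ‖e‖ ^ 2 *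
        ((‖v + t • e‖ ^ 2)⁻¹) ^ 4 := by
  set σ := ‖v + t • e‖ ^ 2 with hσ
  have hρv : ρ₀ ^ 2 ≤ ‖v‖ ^ 2 := pow_le_pow_left₀ hρ.le hv 2
  have hσ₀ : ρ₀ ^ 2 ≤ σ := hρv.trans (le_trans (by nlinarith) (h1_line_norm_sq_ge hve ht).1)
  have hσpos : 0 < σ := lt_of_lt_of_le (by positivity) hσ₀
  have hW1 := h1_abs_ljSqDeriv_le (by positivity : (0 : ℝ) < ρ₀ ^ 2) hσ₀
  have hW2 := abs_ljSqDeriv_deriv_le (by positivity : (0 : ℝ) < ρ₀ ^ 2) hσ₀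
  have hCS : inner ℝ (v + t • e) e ^ 2 ≤ σ * ‖e‖ ^ 2 := by
    have := abs_real_inner_le_norm (v + t • e) e
    have h0 : 0 ≤ ‖v + t • e‖ * ‖e‖ := by positivity
    calc inner ℝ (v + t • e) e ^ 2 = |inner ℝ (v + t • e) e| ^ 2 := (sq_abs _).symm
      _ ≤ (‖v + t • e‖ * ‖e‖) ^ 2 := pow_le_pow_left₀ (abs_nonneg _) this 2
      _ = σ * ‖e‖ ^ 2 := by rw [hσ]; ring
  set C₁ : ℝ := 1 / 2 * (1 + ((ρ₀ ^ 2)⁻¹) ^ 3)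
  set C₂ : ℝ := 2 + 7 / 2 * ((ρ₀ ^ 2)⁻¹) ^ 3
  have hC₁ : 0 ≤ C₁ := by positivity
  have hC₂ : 0 ≤ C₂ := by positivity
  have hi5 : (σ⁻¹) ^ 5 * σ = (σ⁻¹) ^ 4 := by field_simp
  calc |(7 / 2 * (σ⁻¹) ^ 8 - 2 * (σ⁻¹) ^ 5) * (2 * inner ℝ (v + t • e) e ^ 2) + ljSqDeriv σ * ‖e‖ ^ 2|
      ≤ |(7 / 2 * (σ⁻¹) ^ 8 - 2 * (σ⁻¹) ^ 5) * (2 * inner ℝ (v + t • e) e ^ 2)| + |ljSqDeriv σ * ‖e‖ ^ 2| :=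
        abs_add_le _ _
    _ = |7 / 2 * (σ⁻¹) ^ 8 - 2 * (σ⁻¹) ^ 5| * (2 * inner ℝ (v + t • e) e ^ 2) + |ljSqDeriv σ| * ‖e‖ ^ 2 := by
        have ha : |(7 / 2 * (σ⁻¹) ^ 8 - 2 * (σ⁻¹) ^ 5) * (2 * inner ℝ (v + t • e) e ^ 2)| =
            |7 / 2 * (σ⁻¹) ^ 8 - 2 * (σ⁻¹) ^ 5| * (2 * inner ℝ (v + t • e) e ^ 2) := by
          rw [abs_mul (7 / 2 * (σ⁻¹) ^ 8 - 2 * (σ⁻¹) ^ 5), abs_of_nonneg (by positivity : (0:ℝ) ≤ 2 * inner ℝ (v + t • e) e ^ 2)]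
        have hb : |ljSqDeriv σ * ‖e‖ ^ 2| = |ljSqDeriv σ| * ‖e‖ ^ 2 := by
          rw [abs_mul, abs_of_nonneg (by positivity : (0:ℝ) ≤ ‖e‖ ^ 2)]
        rw [ha, hb]
    _ ≤ C₂ * (σ⁻¹) ^ 5 * (2 * (σ * ‖e‖ ^ 2)) + C₁ * (σ⁻¹) ^ 4 * ‖e‖ ^ 2 := by
        gcongr
    _ = (2 * C₂ + C₁) * ‖e‖ ^ 2 * (σ⁻¹) ^ 4 := by
        rw [show C₂ * (σ⁻¹) ^ 5 * (2 * (σ * ‖e‖ ^ 2)) = 2 * C₂ * ‖e‖ ^ 2 * ((σ⁻¹) ^ 5 * σ) by ring, hi5]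
        ring

/-- **One Euler–Maclaurin step.**  On an outgoing line, for every integer step `[k, k+1]`, `k ≥ 0`:
`|F(k+1) − (Φ(k+1) − Φ(k))| ≤ (2C₂ + C₁)‖e‖²(‖v + ke‖²)⁻⁴` (mean value theorem twice, monotonicity of `‖v+te‖²`). [folklore] -/
theorem h1_tail_step (hρ : 0 < ρ₀) (hv : ρ₀ ≤ ‖v‖) (hve : 0 ≤ inner ℝ v e) {k : ℝ}
    (hk : 0 ≤ k) :
    |ljSqDeriv (‖v + (k + 1) • e‖ ^ 2) * inner ℝ (v + (k + 1) • e) e -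
        (1 / 2 * (1 / 12 * ((‖v + (k + 1) • e‖ ^ 2)⁻¹) ^ 6 - 1 / 6 * ((‖v + (k + 1) • e‖ ^ 2)⁻¹) ^ 3) -
          1 / 2 * (1 / 12 * ((‖v + k • e‖ ^ 2)⁻¹) ^ 6 - 1 / 6 * ((‖v + k • e‖ ^ 2)⁻¹) ^ 3))| ≤
      (2 * (2 + 7 / 2 * ((ρ₀ ^ 2)⁻¹) ^ 3) + 1 / 2 * (1 + ((ρ₀ ^ 2)⁻¹) ^ 3)) * ‖e‖ ^ 2 *
        ((‖v + k • e‖ ^ 2)⁻¹) ^ 4 := by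
  set K : ℝ := (2 * (2 + 7 / 2 * ((ρ₀ ^ 2)⁻¹) ^ 3) + 1 / 2 * (1 + ((ρ₀ ^ 2)⁻¹) ^ 3)) with hK
  -- names
  set Φ : ℝ → ℝ := fun t => 1 / 2 * (1 / 12 * ((‖v + t • e‖ ^ 2)⁻¹) ^ 6 - 1 / 6 * ((‖v + t • e‖ ^ 2)⁻¹) ^ 3) with hΦ
  set F : ℝ → ℝ := fun t => ljSqDeriv (‖v + t • e‖ ^ 2) * inner ℝ (v + t • e) e with hF
  set F' : ℝ → ℝ := fun t => (7 / 2 * ((‖v + t • e‖ ^ 2)⁻¹) ^ 8 - 2 * ((‖v + t • e‖ ^ 2)⁻¹) ^ 5) *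
      (2 * inner ℝ (v + t • e) e ^ 2) + ljSqDeriv (‖v + t • e‖ ^ 2) * ‖e‖ ^ 2 with hF'
  have hρv : ρ₀ ^ 2 ≤ ‖v‖ ^ 2 := pow_le_pow_left₀ hρ.le hv 2
  have hqpos : ∀ t : ℝ, 0 ≤ t → 0 < ‖v + t • e‖ ^ 2 := fun t ht =>
    lt_of_lt_of_le (by positivity : (0:ℝ) < ρ₀ ^ 2) (hρv.trans (le_trans (by nlinarith) (h1_line_norm_sq_ge hve ht).1))
  have hdΦ : ∀ t : ℝ, 0 ≤ t → HasDerivAt Φ (F t) t := fun t ht => h1_line_hasDerivAt_prim (hqpos t ht).ne'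
  have hdF : ∀ t : ℝ, 0 ≤ t → HasDerivAt F (F' t) t := fun t ht => h1_line_hasDerivAt_load (hqpos t ht).ne'
  -- first mean value theorem: Φ(k+1) − Φ(k) = F ξ
  have hab : k < k + 1 := by linarith
  obtain ⟨ξ, hξ, hξeq⟩ := exists_hasDerivAt_eq_slope Φ F hab
    (fun t ht => (hdΦ t (hk.trans ht.1)).continuousAt.continuousWithinAt)
    (fun t ht => hdΦ t (hk.trans ht.1.le))
  rw [add_sub_cancel_left, div_one] at hξeq
  -- second mean value theorem on [ξ, k+1]: F(k+1) − F ξ = F' η (k + 1 − ξ)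
  have hξk : k < ξ := hξ.1
  have hξ1 : ξ < k + 1 := hξ.2
  obtain ⟨η, hη, hηeq⟩ := exists_hasDerivAt_eq_slope F F' hξ1
    (fun t ht => (hdF t (by linarith [ht.1])).continuousAt.continuousWithinAt)
    (fun t ht => hdF t (by linarith [ht.1]))
  have hηk : k ≤ η := by linarith [hη.1]
  have hden : 0 < k + 1 - ξ := by linarith
  have hFdiff : F (k + 1) - F ξ = F' η * (k + 1 - ξ) := by
    rw [hηeq]; field_simp
  have hbound : |F' η| ≤ K * ‖e‖ ^ 2 * ((‖v + η • e‖ ^ 2)⁻¹) ^ 4 :=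
    h1_line_load_deriv_le hρ hv hve (hk.trans hηk)
  have hmono : ((‖v + η • e‖ ^ 2)⁻¹) ^ 4 ≤ ((‖v + k • e‖ ^ 2)⁻¹) ^ 4 := by
    apply pow_le_pow_left₀ (by positivity)
    exact inv_anti₀ (hqpos k hk) (h1_line_norm_sq_mono hve hk hηk)
  have hKe : 0 ≤ K * ‖e‖ ^ 2 := by positivity
  -- assemble
  have eq1 : F (k + 1) - (Φ (k + 1) - Φ k) = F' η * (k + 1 - ξ) := by rw [← hξeq, ← hFdiff]
  show |F (k + 1) - (Φ (k + 1) - Φ k)| ≤ K * ‖e‖ ^ 2 * ((‖v + k • e‖ ^ 2)⁻¹) ^ 4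
  rw [eq1, abs_mul, abs_of_pos hden]
  calc |F' η| * (k + 1 - ξ) ≤ K * ‖e‖ ^ 2 * ((‖v + η • e‖ ^ 2)⁻¹) ^ 4 * 1 :=
        mul_le_mul hbound (by linarith) hden.le (by positivity)
    _ ≤ K * ‖e‖ ^ 2 * ((‖v + k • e‖ ^ 2)⁻¹) ^ 4 := by
        rw [mul_one]; exact mul_le_mul_of_nonneg_left hmono hKe

/-- **The primitive tends to zero along the line**: `½W(‖v + n e‖²) → 0`. [folklore] -/
theorem h1_line_prim_tendsto_zero (hρ : 0 < ρ₀) (hv : ρ₀ ≤ ‖v‖) (he : ρ₀ ≤ ‖e‖) (hve : 0 ≤ inner ℝ v e) :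
    Tendsto (fun n : ℕ => 1 / 2 * (1 / 12 * ((‖v + (n : ℝ) • e‖ ^ 2)⁻¹) ^ 6 -
      1 / 6 * ((‖v + (n : ℝ) • e‖ ^ 2)⁻¹) ^ 3)) atTop (𝓝 0) := by
  have hρ2 : 0 < ρ₀ ^ 2 := by positivity
  have hρv : ρ₀ ^ 2 ≤ ‖v‖ ^ 2 := pow_le_pow_left₀ hρ.le hv 2
  have hρe : ρ₀ ^ 2 ≤ ‖e‖ ^ 2 := pow_le_pow_left₀ hρ.le he 2
  have hlow : ∀ n : ℕ, (n : ℝ) * ρ₀ ^ 2 ≤ ‖v + (n : ℝ) • e‖ ^ 2 := by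
    intro n
    have hn : (0 : ℝ) ≤ n := Nat.cast_nonneg n
    have h1 := (h1_line_norm_sq_ge hve hn).1
    have h2 : (n : ℝ) ^ 2 * ‖e‖ ^ 2 ≥ (n : ℝ) ^ 2 * ρ₀ ^ 2 := by gcongr
    nlinarith [sq_nonneg ((n : ℝ) - 1)]
  have hq : Tendsto (fun n : ℕ => ‖v + (n : ℝ) • e‖ ^ 2) atTop atTop :=
    tendsto_atTop_mono hlow (tendsto_natCast_atTop_atTop.atTop_mul_const hρ2)
  have hy : Tendsto (fun n : ℕ => (‖v + (n : ℝ) • e‖ ^ 2)⁻¹) atTop (𝓝 0) := tendsto_inv_atTop_zero.comp hq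
  have := (((hy.pow 6).const_mul (1 / 12 : ℝ)).sub ((hy.pow 3).const_mul (1 / 6 : ℝ))).const_mul (1 / 2 : ℝ)
  simpa using this

/-- **Euler–Maclaurin asymptotics of the outgoing line-truss tail.**  For `‖v‖, ‖e‖ ≥ ρ₀ > 0` and `⟪v, e⟫ ≥ 0`,
`|Σ_{m ≥ 1} W′(‖v + m e‖²)⟪v + m e, e⟫ + ½·V_LJ(‖v‖)| ≤ 16(2C₂ + C₁)‖e‖²((‖v‖⁻¹)⁸ + (‖v‖⁻¹)⁷/(6‖e‖))` with
`C₁ = ½(1 + ρ₀⁻⁶)`, `C₂ = 2 + (7/2)ρ₀⁻⁶` — the tension of the line truss is `−½V_LJ(r) + O(‖e‖ r⁻⁷) = r⁻⁶/12 + O(a r⁻⁷)`,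
so the readout coefficient `β = λ_s τ` of the landed first-order design is isotropic at leading order (telescoping of the primitive
`½W(‖v+te‖²)`, `h1_tail_step`, `h1_tail_bound`). [folklore] -/
theorem h1_tail_asymp (hρ : 0 < ρ₀) (hv : ρ₀ ≤ ‖v‖) (he : ρ₀ ≤ ‖e‖) (hve : 0 ≤ inner ℝ v e) :
    |∑' m : ℕ, ljSqDeriv (‖v + ((m : ℝ) + 1) • e‖ ^ 2) * inner ℝ (v + ((m : ℝ) + 1) • e) e +
        1 / 2 * lennardJones ‖v‖| ≤
      16 * (2 * (2 + 7 / 2 * ((ρ₀ ^ 2)⁻¹) ^ 3) + 1 / 2 * (1 + ((ρ₀ ^ 2)⁻¹) ^ 3)) * ‖e‖ ^ 2 *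
        ((‖v‖⁻¹) ^ 8 + (‖v‖⁻¹) ^ 7 / (6 * ‖e‖)) := by
  set K : ℝ := 2 * (2 + 7 / 2 * ((ρ₀ ^ 2)⁻¹) ^ 3) + 1 / 2 * (1 + ((ρ₀ ^ 2)⁻¹) ^ 3) with hK
  have hK0 : 0 ≤ K := by positivity
  have hvpos : 0 < ‖v‖ := hρ.trans_le hv
  have hepos : 0 < ‖e‖ := hρ.trans_le he
  -- the three sequences
  set Φ : ℝ → ℝ := fun t => 1 / 2 * (1 / 12 * ((‖v + t • e‖ ^ 2)⁻¹) ^ 6 - 1 / 6 * ((‖v + t • e‖ ^ 2)⁻¹) ^ 3)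
    with hΦ
  set F : ℝ → ℝ := fun t => ljSqDeriv (‖v + t • e‖ ^ 2) * inner ℝ (v + t • e) e with hF
  set b : ℕ → ℝ := fun m => ((‖v‖ + (m : ℝ) * ‖e‖)⁻¹) ^ 8 with hb
  have hb0 : ∀ m, 0 ≤ b m := fun m => by positivity
  -- summability of the load line (h1_master)
  have hFsum : Summable fun m : ℕ => F ((m : ℝ) + 1) := (h1_master hρ hv he hve).1
  -- the Euler–Maclaurin step, dominated by `K‖e‖²·16·b m`
  have hstep : ∀ m : ℕ, |F ((m : ℝ) + 1) - (Φ ((m : ℝ) + 1) - Φ m)| ≤ K * ‖e‖ ^ 2 * (16 * b m) := by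
    intro m
    have hm : (0 : ℝ) ≤ m := Nat.cast_nonneg m
    have h1 := h1_tail_step hρ hv hve hm
    have hS : 0 < ‖v‖ + (m : ℝ) * ‖e‖ := by positivity
    have h2 : ((‖v + (m : ℝ) • e‖ ^ 2)⁻¹) ^ 4 ≤ 16 * b m := by
      have hw2 := (h1_line_norm_sq_ge hve hm).2
      have hinv1 : (‖v + (m : ℝ) • e‖ ^ 2)⁻¹ ≤ 2 * ((‖v‖ + (m : ℝ) * ‖e‖)⁻¹) ^ 2 := by
        calc (‖v + (m : ℝ) • e‖ ^ 2)⁻¹ ≤ ((‖v‖ + (m : ℝ) * ‖e‖) ^ 2 / 2)⁻¹ := inv_anti₀ (by positivity) hw2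
          _ = 2 * ((‖v‖ + (m : ℝ) * ‖e‖)⁻¹) ^ 2 := by rw [inv_div, inv_pow]; ring
      calc ((‖v + (m : ℝ) • e‖ ^ 2)⁻¹) ^ 4 ≤ (2 * ((‖v‖ + (m : ℝ) * ‖e‖)⁻¹) ^ 2) ^ 4 :=
            pow_le_pow_left₀ (by positivity) hinv1 4
        _ = 16 * b m := by rw [hb]; ring
    exact h1.trans (mul_le_mul_of_nonneg_left h2 (by positivity))
  -- summability of `b`
  obtain ⟨h7s, h7b⟩ := h1_tail_bound hvpos hepos
  have hshift : Summable fun m : ℕ => b (m + 1) := by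
    have hdom : Summable fun m : ℕ => ‖v‖⁻¹ * ((‖v‖ + ((m : ℝ) + 1) * ‖e‖)⁻¹) ^ 7 := h7s.mul_left _
    refine Summable.of_nonneg_of_le (fun m => hb0 (m + 1)) (fun m => ?_) hdom
    have hS : ‖v‖ ≤ ‖v‖ + ((m : ℝ) + 1) * ‖e‖ := by nlinarith [hepos.le]
    have hSpos : 0 < ‖v‖ + ((m : ℝ) + 1) * ‖e‖ := by positivity
    have hi : (‖v‖ + ((m : ℝ) + 1) * ‖e‖)⁻¹ ≤ ‖v‖⁻¹ := inv_anti₀ hvpos hS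
    have e1 : b (m + 1) = ((‖v‖ + ((m : ℝ) + 1) * ‖e‖)⁻¹) ^ 8 := by rw [hb]; push_cast; ring
    rw [e1, show ((‖v‖ + ((m : ℝ) + 1) * ‖e‖)⁻¹) ^ 8 =
        (‖v‖ + ((m : ℝ) + 1) * ‖e‖)⁻¹ * ((‖v‖ + ((m : ℝ) + 1) * ‖e‖)⁻¹) ^ 7 by ring]
    exact mul_le_mul_of_nonneg_right hi (by positivity)
  have hbsum : Summable b := (summable_nat_add_iff 1).mp hshift
  have hbtsum : ∑' m, b m ≤ (‖v‖⁻¹) ^ 8 + (‖v‖⁻¹) ^ 7 / (6 * ‖e‖) := by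
    rw [hbsum.tsum_eq_zero_add]
    have e0 : b 0 = (‖v‖⁻¹) ^ 8 := by rw [hb]; simp
    rw [e0]
    gcongr
    calc ∑' m : ℕ, b (m + 1) ≤ ∑' m : ℕ, ‖v‖⁻¹ * ((‖v‖ + ((m : ℝ) + 1) * ‖e‖)⁻¹) ^ 7 := by
          refine Summable.tsum_le_tsum (fun m => ?_) hshift (h7s.mul_left _)
          have hS : ‖v‖ ≤ ‖v‖ + ((m : ℝ) + 1) * ‖e‖ := by nlinarith [hepos.le]
          have hi : (‖v‖ + ((m : ℝ) + 1) * ‖e‖)⁻¹ ≤ ‖v‖⁻¹ := inv_anti₀ hvpos hS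
          have e1 : b (m + 1) = ((‖v‖ + ((m : ℝ) + 1) * ‖e‖)⁻¹) ^ 8 := by rw [hb]; push_cast; ring
          rw [e1, show ((‖v‖ + ((m : ℝ) + 1) * ‖e‖)⁻¹) ^ 8 =
              (‖v‖ + ((m : ℝ) + 1) * ‖e‖)⁻¹ * ((‖v‖ + ((m : ℝ) + 1) * ‖e‖)⁻¹) ^ 7 by ring]
          exact mul_le_mul_of_nonneg_right hi (by positivity)
      _ = ‖v‖⁻¹ * ∑' m : ℕ, ((‖v‖ + ((m : ℝ) + 1) * ‖e‖)⁻¹) ^ 7 := tsum_mul_left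
      _ ≤ ‖v‖⁻¹ * ((‖v‖⁻¹) ^ 6 / (6 * ‖e‖)) := mul_le_mul_of_nonneg_left h7b (by positivity)
      _ = (‖v‖⁻¹) ^ 7 / (6 * ‖e‖) := by ring
  -- summability and sum of the telescoping sequence
  have htele : Summable fun m : ℕ => Φ ((m : ℝ) + 1) - Φ m := by
    refine Summable.of_norm_bounded (g := fun m : ℕ => |F ((m : ℝ) + 1)| + K * ‖e‖ ^ 2 * (16 * b m))
      (hFsum.abs.add ((hbsum.mul_left 16).mul_left _)) fun m => ?_
    rw [Real.norm_eq_abs]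
    have := hstep m
    have e1 : Φ ((m : ℝ) + 1) - Φ m = F ((m : ℝ) + 1) - (F ((m : ℝ) + 1) - (Φ ((m : ℝ) + 1) - Φ m)) := by ring
    rw [e1]
    exact (abs_sub _ _).trans (by linarith)
  have htele_sum : ∑' m : ℕ, (Φ ((m : ℝ) + 1) - Φ m) = -Φ 0 := by
    have h1 : Tendsto (fun n : ℕ => ∑ i ∈ Finset.range n, (Φ ((i : ℝ) + 1) - Φ i)) atTop
        (𝓝 (∑' m : ℕ, (Φ ((m : ℝ) + 1) - Φ m))) := htele.hasSum.tendsto_sum_nat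
    have h2 : (fun n : ℕ => ∑ i ∈ Finset.range n, (Φ ((i : ℝ) + 1) - Φ i)) = fun n : ℕ => Φ n - Φ 0 := by
      funext n
      have := Finset.sum_range_sub (fun i : ℕ => Φ i) n
      push_cast at this ⊢
      exact this
    rw [h2] at h1
    have h3 : Tendsto (fun n : ℕ => Φ n - Φ 0) atTop (𝓝 (0 - Φ 0)) :=
      (h1_line_prim_tendsto_zero hρ hv he hve).sub tendsto_const_nhds
    have := tendsto_nhds_unique h1 h3
    rw [this]; ring
  -- the difference sequence
  have hdiff : Summable fun m : ℕ => F ((m : ℝ) + 1) - (Φ ((m : ℝ) + 1) - Φ m) := hFsum.sub htele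
  have hmain : ∑' m : ℕ, F ((m : ℝ) + 1) + Φ 0 = ∑' m : ℕ, (F ((m : ℝ) + 1) - (Φ ((m : ℝ) + 1) - Φ m)) := by
    rw [hFsum.tsum_sub htele, htele_sum]; ring
  have hΦ0 : Φ 0 = 1 / 2 * lennardJones ‖v‖ := by
    rw [hΦ, lennardJones]
    simp only [zero_smul, add_zero, inv_pow]
    ring
  -- assemble
  have hF' : (fun m : ℕ => ljSqDeriv (‖v + ((m : ℝ) + 1) • e‖ ^ 2) * inner ℝ (v + ((m : ℝ) + 1) • e) e) =
      fun m : ℕ => F ((m : ℝ) + 1) := by funext m; rw [hF]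
  rw [hF', ← hΦ0, hmain]
  calc |∑' m : ℕ, (F ((m : ℝ) + 1) - (Φ ((m : ℝ) + 1) - Φ m))|
      ≤ ∑' m : ℕ, |F ((m : ℝ) + 1) - (Φ ((m : ℝ) + 1) - Φ m)| := h1_abs_tsum_le hdiff
    _ ≤ ∑' m : ℕ, K * ‖e‖ ^ 2 * (16 * b m) :=
        Summable.tsum_le_tsum hstep hdiff.abs ((hbsum.mul_left 16).mul_left _)
    _ = K * ‖e‖ ^ 2 * (16 * ∑' m : ℕ, b m) := by rw [tsum_mul_left, tsum_mul_left]
    _ ≤ K * ‖e‖ ^ 2 * (16 * ((‖v‖⁻¹) ^ 8 + (‖v‖⁻¹) ^ 7 / (6 * ‖e‖))) := by gcongr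
    _ = 16 * K * ‖e‖ ^ 2 * ((‖v‖⁻¹) ^ 8 + (‖v‖⁻¹) ^ 7 / (6 * ‖e‖)) := by ring

end Line

end Summit.AtomisticToContinuum.Crystallization.Theorems.StrictSplittingRuleBirth

end
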